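import Summits.ABC.ABC.Theorems.TowerFourSubLiouville.Negative.FixedFormsDirichlet

/-!
# `TowerFourSubLiouville` (stmt-ABC-1649): the `UniformLjunggren` floor `K ≥ 1/2` already holds on the
# crux fibre `(v, w) = (1, 2)` (Dirichlet for `⁴√2`)

Companion to `Negative.HallLangTransfer` (p131589; standing disprover, cycle 8, refuter-cdisprove-stmt-ABC-1649-g8-0).
There `UniformLjunggren K` (`x² − d y⁴ = k`, `d ≠ □`, `k ≠ 0 ⟹ |y| ≤ C(|d||k|)^K`; round-2 card
`cm-hall-lang-transfer`) is refuted for every `K < 1/2` by a polynomial identity whose `x` is NOT of the shape the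
crux feeds into the transfer.  The crux uses the transfer only through the DOUBLY-SQUARE fibre
`(d, k, x, y) = (v w, a w, w Z², Y)` of a coprime violator `w Z⁴ = v Y⁴ + a` (card: `(x,y²)` a square-denominator
approximation to `√(vw)`).  This file shows that the floor `K ≥ 1/2` persists on that fibre, indeed on the single
form `(v, w) = (1, 2)`: by Dirichlet's theorem for `⁴√2` (cycle 5, `Negative.FixedFormsDirichlet.exists_good_approx`:
for every `B` a coprime `(Y, Z)`, `Z > B`, with `|2Z⁴ − Y⁴| ≤ 43 Z²`) the solutions
`(2Z²)² − 2·Y⁴ = 2(2Z⁴ − Y⁴) =: k`, `|2|·|k| ≤ 172 Z²`, `Y ≥ Z` (once `Z ≥ 7`) violate `|y| ≤ C (|d||k|)^K` for every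
`K < 1/2` and every `C` (`not_uniformLjunggren_fibre12_of_lt_half`; instantiating the landed
`not_uniformLjunggren_of_lt_half`'s matrix at `d = 2` — `2` is not a square — gives it a second, crux-shaped proof).  In the two-exponent diagram of the core this is
the Dirichlet corner `(θ, φ) = (0, 2)`; in Hall–Lang coordinates (`x = v w Y² = 2Y²`, `N = a v w² = 4(2Z⁴ − Y⁴)`) these
crux-shaped integral points have `log x / log|N| → 1` only — every known enemy family of the core has crux-shaped
ratio `(2θ + 2)/(φ + 3θ) ≤ 1` (Dirichlet `1`, `padeFamily₁` `6/7`, `padeFamily₂` `8/9`), while a violator of the crux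
with `UBQ`-exponent `η` would have ratio `≥ (2 + 2η)/(4η) → ∞`: the `κ ∈ [1, 3/2)` refutation of `HallLang1728 κ` in
`Negative.HallLangTransfer` lives OFF the crux shape.  Negative lemma only; no Theses decl is asserted.
-/

-- `Summit.ABC.ABC` is the mandated summit-side namespace (CONVENTIONS §2); the duplicate is deliberate.
set_option linter.dupNamespace false

namespace Summit.ABC.ABC.Theorems.TowerFourSubLiouville.Negative

/-- **`UniformLjunggren K` fails for `K < 1/2` on the crux fibre `(v, w) = (1, 2)`**: the matrix of
`SketchIdeator5.UniformLjunggren K` specialised to `d = 2` and `x = 2Z²` (so `x² − 2y⁴ = 2(2Z⁴ − y⁴)`), witnesses from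
Dirichlet's theorem for `⁴√2`. -/
theorem not_uniformLjunggren_fibre12_of_lt_half (K : ℝ) (hK : K < 1 / 2) :
    ¬ ∃ C : ℝ, 0 < C ∧ ∀ k x y : ℤ, (∃ Z : ℤ, x = 2 * Z ^ 2) → k ≠ 0 → x ^ 2 - 2 * y ^ 4 = k →
      (|y| : ℝ) ≤ C * ((|(2 : ℤ)| * |k| : ℤ) : ℝ) ^ K := by
  rintro ⟨C, hC, h⟩
  set K' : ℝ := max K 0 with hK'def
  have hK'0 : 0 ≤ K' := le_max_right _ _
  have hK'lt : K' < 1 / 2 := max_lt hK (by norm_num)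
  have hs : 2 * K' < 1 := by linarith
  obtain ⟨M, -, hM⟩ := key_growth (K := 2 * C * (172 : ℝ) ^ K') (by positivity) hs
  -- Dirichlet for ⁴√2 beyond `B = max ⌈M⌉₊ 7`
  obtain ⟨xi, hxi0, hxi⟩ : ∃ xi : ℝ, 0 < xi ∧ xi ^ 4 = 2 := by
    obtain ⟨θ, hθ, hθ4⟩ := fixedFormsRoth_exists_fourth_root (v := 1) (w := 2) one_pos two_pos
    exact ⟨θ, hθ, by rw [hθ4]; norm_num⟩
  obtain ⟨Y, Z, hBZ, hY0, -, hval⟩ := exists_good_approx hxi0 hxi (max ⌈M⌉₊ 7)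
  have hZ7 : 7 ≤ Z := le_trans (le_max_right _ _) hBZ.le
  have hZM : M ≤ (Z : ℝ) := by
    have h1 : M ≤ (⌈M⌉₊ : ℝ) := Nat.le_ceil M
    have h2 : ((⌈M⌉₊ : ℕ) : ℝ) ≤ (Z : ℝ) := by exact_mod_cast le_trans (le_max_left _ _) hBZ.le
    linarith
  have hZpos : 0 < Z := by omega
  have hZ0R : (0 : ℝ) ≤ (Z : ℝ) := by positivity
  have hZposR : (0 : ℝ) < (Z : ℝ) := by exact_mod_cast hZpos
  -- the witness on the fibre: k = 2(2Z⁴ − Y⁴), x = 2Z², y = Y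
  have hne : (Y : ℤ) ^ 4 ≠ 2 * (Z : ℤ) ^ 4 := by
    intro h0
    exact pow_four_ne_two_mul_pow_four Y Z hZpos (by exact_mod_cast h0)
  have hk0 : (2 * (2 * (Z : ℤ) ^ 4 - (Y : ℤ) ^ 4)) ≠ 0 := by
    intro h0
    apply hne
    linarith
  have key := h (2 * (2 * (Z : ℤ) ^ 4 - (Y : ℤ) ^ 4)) (2 * (Z : ℤ) ^ 2) (Y : ℤ) ⟨Z, rfl⟩ hk0 (by ring)
  -- sizes in ℝ
  have hdk : ((|(2 : ℤ)| * |2 * (2 * (Z : ℤ) ^ 4 - (Y : ℤ) ^ 4)| : ℤ) : ℝ) ≤ 172 * (Z : ℝ) ^ 2 := by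
    push_cast [Int.cast_abs]
    rw [abs_mul, abs_two]
    linarith
  have hdk1 : (1 : ℝ) ≤ ((|(2 : ℤ)| * |2 * (2 * (Z : ℤ) ^ 4 - (Y : ℤ) ^ 4)| : ℤ) : ℝ) := by
    have h1 : (1 : ℤ) ≤ |2 * (2 * (Z : ℤ) ^ 4 - (Y : ℤ) ^ 4)| := Int.one_le_abs hk0
    have h2 : |(2 : ℤ)| = 2 := by norm_num
    have : (1 : ℤ) ≤ |(2 : ℤ)| * |2 * (2 * (Z : ℤ) ^ 4 - (Y : ℤ) ^ 4)| := by rw [h2]; linarith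
    exact_mod_cast this
  have hdk0 : (0 : ℝ) ≤ ((|(2 : ℤ)| * |2 * (2 * (Z : ℤ) ^ 4 - (Y : ℤ) ^ 4)| : ℤ) : ℝ) := le_trans zero_le_one hdk1
  -- `Y ≥ Z` from `Y⁴ ≥ 2Z⁴ − 43Z² ≥ Z⁴`
  have hY0R : (0 : ℝ) ≤ (Y : ℝ) := by positivity
  have hZY : (Z : ℝ) ≤ (Y : ℝ) := by
    have h49 : (49 : ℝ) ≤ (Z : ℝ) ^ 2 := by
      have : (7 : ℝ) ≤ Z := by exact_mod_cast hZ7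
      nlinarith
    have hlow : (Z : ℝ) ^ 4 ≤ (Y : ℝ) ^ 4 := by
      have := (abs_le.mp hval).2
      nlinarith
    by_contra hlt
    have hlt : (Y : ℝ) < (Z : ℝ) := lt_of_not_ge hlt
    have : (Y : ℝ) ^ 4 < (Z : ℝ) ^ 4 := by
      have h2 : (Y : ℝ) ^ 2 < (Z : ℝ) ^ 2 := by nlinarith
      have hY2 : (0 : ℝ) ≤ (Y : ℝ) ^ 2 := by positivity
      nlinarith
    linarith
  have hyabs : |((Y : ℤ) : ℝ)| = (Y : ℝ) := by
    rw [Int.cast_natCast]; exact abs_of_nonneg hY0R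
  -- growth at `T = Z`, exponent `2K' < 1`
  have h4 := hM (Z : ℝ) hZM
  have h3 : ((172 : ℝ) * (Z : ℝ) ^ 2) ^ K' = (172 : ℝ) ^ K' * (Z : ℝ) ^ (2 * K') := by
    rw [Real.mul_rpow (by norm_num) (by positivity), ← Real.rpow_natCast (Z : ℝ) 2, ← Real.rpow_mul hZ0R]
    norm_num
  have h5 : C * (172 : ℝ) ^ K' * (Z : ℝ) ^ (2 * K') < (Z : ℝ) := by linarith
  have : |((Y : ℤ) : ℝ)| < |((Y : ℤ) : ℝ)| :=
    calc |((Y : ℤ) : ℝ)| ≤ C * ((|(2 : ℤ)| * |2 * (2 * (Z : ℤ) ^ 4 - (Y : ℤ) ^ 4)| : ℤ) : ℝ) ^ K := key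
      _ ≤ C * ((|(2 : ℤ)| * |2 * (2 * (Z : ℤ) ^ 4 - (Y : ℤ) ^ 4)| : ℤ) : ℝ) ^ K' :=
          mul_le_mul_of_nonneg_left (Real.rpow_le_rpow_of_exponent_le hdk1 (le_max_left _ _)) hC.le
      _ ≤ C * ((172 : ℝ) * (Z : ℝ) ^ 2) ^ K' :=
          mul_le_mul_of_nonneg_left (Real.rpow_le_rpow hdk0 hdk hK'0) hC.le
      _ = C * (172 : ℝ) ^ K' * (Z : ℝ) ^ (2 * K') := by rw [h3]; ring
      _ < (Z : ℝ) := h5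
      _ ≤ (Y : ℝ) := hZY
      _ = |((Y : ℤ) : ℝ)| := hyabs.symm
  exact lt_irrefl _ this

end Summit.ABC.ABC.Theorems.TowerFourSubLiouville.Negative
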